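import Mathlib
import HarnessLib
import Summits.HubbardSuperconductivity.HubbardSuperconductivity.Theorems.KLProgrammeKLRegimeWickOrderedStep
import Literature.MathematicalPhysics.QuantumLattice.GrassmannWickOrderedRGE
import Literature.MathematicalPhysics.QuantumLattice.GrassmannIntegrationByParts

/-!
# Route `KLProgramme` — crux K3, ENGINE child gen 5 (stmt-HubbardSuperconductivity-19918 `KLRegimeEngineV14`), stub `stub_engine_step_values`,
# conjunct (E2-v9) at `1 ≤ n`: the bilinear term of the Wick-ordered RGE is a Wick STAR product — `klwf_gaussConv_derivPairing_eq_sum_wickStar`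

Cell gate-hubbard-kl, seat hubbard-kl-k3c1-p1 (g5), technique «composed-map remainder propagation» (continuous organisation of the (E2) step,
HOME/hubbard-kl-k3c1-p1/E2-CONTINUOUS-ROUTE.md, evidence #24 on 19918).  The tree has Salmhofer's RGE in Wick-ordered coordinates
(`GrassmannWickOrderedRGE.hasDerivAt_wickKernel_salmhofer`: `∂_t G_m(t|X) = ½·wickKernel D_t (δ𝒢/δψ, Ċ_t δ𝒢/δψ) m X`) and the Wick star product of the
discrete scheme (`KLRegimeWick.wickStar`, with its cross-contraction expansion `wickStar_eq_dblFold_gaussConv_cross`, p483614).  This file is the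
one-line glue between them: smeared by `e^{Δ_D}`, the bilinear term of the RGE is the `Ċ`-contraction of two leg derivatives of the Wick carrier
`𝒲 = e^{Δ_D}𝒢` multiplied with the Wick star product,
`e^{Δ_D}(δ𝒢/δψ, Ċ δ𝒢/δψ)_Γ = Σ_{X,Y} Ċ_{XY} • (∂_X 𝒲) ⋆_D (∂_Y 𝒲)`
(derivatives commute with `e^{±Δ_D}`) — so the source of the within-slice flow is a sum of TWO-VERTEX graphs with one `Ċ` line and any number of
`D` lines between the vertices (Salmhofer 1998 Prop. 2's left side in the tree's vocabulary), to which the landed colouring/channel machinery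
applies with the line pair `(Ċ, D)`.  §2 restates `hasDerivAt_wickKernel_salmhofer` in this form.  Generic finite Grassmann algebra; nothing
about the model is asserted.  0 kit.
-/

noncomputable section

namespace Summit.HubbardSuperconductivity.HubbardSuperconductivity.Theorems.KLRegimeWick

set_option linter.dupNamespace false -- summit = problem name (single-conjunct summit), D-0017

open Finset Literature.MathematicalPhysics.QuantumLattice GrassmannAlgebra

/-! ## §1 The smeared derivative pairing as a sum of Wick star products -/

section Generic

variable (R : Type*) [CommRing R] [Algebra ℚ R] {Γ : Type*} [Fintype Γ]

/-- `e^{-Δ_D}(∂_X(e^{Δ_D} a)) = ∂_X a`: leg derivatives commute with the (un)smearing. -/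
theorem klwf_gaussConv_neg_deriv_gaussConv (D : Matrix Γ Γ R) (X : Γ) (a : GrassmannAlgebra R Γ) :
    gaussConv R (-D) (grassmannDeriv R X (gaussConv R D a)) = grassmannDeriv R X a := by
  rw [grassmannDeriv_gaussConv, gaussConv_neg_gaussConv_apply]

/-- **The smeared bilinear term is a sum of Wick star products**:
`e^{Δ_D}(δa/δψ, C δb/δψ)_Γ = Σ_{X,Y} C_{XY} • (∂_X(e^{Δ_D}a)) ⋆_D (∂_Y(e^{Δ_D}b))`. -/
theorem klwf_gaussConv_derivPairing_eq_sum_wickStar (D C : Matrix Γ Γ R) (a b : GrassmannAlgebra R Γ) :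
    gaussConv R D (grassmannDerivPairing R C a b) =
      ∑ X, ∑ Y, C X Y • wickStar R D (grassmannDeriv R X (gaussConv R D a)) (grassmannDeriv R Y (gaussConv R D b)) := by
  rw [grassmannDerivPairing_apply, map_sum]
  refine sum_congr rfl fun X _ => ?_
  rw [map_sum]
  refine sum_congr rfl fun Y _ => ?_
  rw [map_smul, wickStar, klwf_gaussConv_neg_deriv_gaussConv, klwf_gaussConv_neg_deriv_gaussConv]

end Generic

/-! ## §2 The Wick-ordered coefficient flow with the star-product source -/

section Flow

variable {𝕂 : Type*} [NontriviallyNormedField 𝕂] {𝕜 : Type*} [RCLike 𝕜] [NormedAlgebra 𝕂 𝕜]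
variable {Γ : Type*} [LinearOrder Γ] [Fintype Γ]

/-- **The Wick-ordered coefficient flow, source in star-product form.**  For the effective action `𝒢(r) = c(r) − 𝒱_r` along an entrywise
differentiable covariance `C_r` (Wick carrier `𝒲_t = e^{Δ_{D_t}}𝒢(t)`, `D_t = C∞ − C_t`), the Wick-ordered coefficient functions satisfy
`∂_t G_m(t|X) = ½ · kernel (Σ_{Y,Y′} Ċ_{YY′} • (∂_Y 𝒲_t) ⋆_{D_t} (∂_{Y′} 𝒲_t)) m X` (`hasDerivAt_wickKernel_salmhofer` + §1). -/
theorem klwf_hasDerivAt_wickKernel_star {C : 𝕂 → Matrix Γ Γ 𝕜} {C' : Matrix Γ Γ 𝕜} {t : 𝕂}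
    (Cinf : Matrix Γ Γ 𝕜) (hC : ∀ X Y, HasDerivAt (fun r => C r X Y) (C' X Y) t) {V : GrassmannAlgebra 𝕜 Γ}
    (hV0 : constPart 𝕜 V = 0) (hVe : V ∈ evenOdd 𝕜 0) (hZt : effPartitionFn 𝕜 (C t) V ≠ 0)
    {c : 𝕂 → 𝕜} {c' : 𝕜} (hc : HasDerivAt c c' t)
    (hc' : c' = -constPart 𝕜 (grassmannLaplacian 𝕜 C' (effAction 𝕜 (C t) V)
            - (2 : 𝕜)⁻¹ • grassmannDerivPairing 𝕜 C' (effAction 𝕜 (C t) V) (effAction 𝕜 (C t) V)))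
    (m : ℕ) (X : Fin m → Γ) :
    HasDerivAt
      (fun r => wickKernel 𝕜 (Cinf - C r) (algebraMap 𝕜 (GrassmannAlgebra 𝕜 Γ) (c r) - effAction 𝕜 (C r) V) m X)
      ((2 : 𝕜)⁻¹ * kernel 𝕜 (∑ Y, ∑ Y', C' Y Y' •
        wickStar 𝕜 (Cinf - C t)
          (grassmannDeriv 𝕜 Y (gaussConv 𝕜 (Cinf - C t) (algebraMap 𝕜 _ (c t) - effAction 𝕜 (C t) V)))
          (grassmannDeriv 𝕜 Y' (gaussConv 𝕜 (Cinf - C t) (algebraMap 𝕜 _ (c t) - effAction 𝕜 (C t) V)))) m X) t := by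
  classical
  have h := hasDerivAt_wickKernel_salmhofer Cinf hC hV0 hVe hZt hc hc' m X
  rwa [wickKernel_def, klwf_gaussConv_derivPairing_eq_sum_wickStar] at h

end Flow

end Summit.HubbardSuperconductivity.HubbardSuperconductivity.Theorems.KLRegimeWick

end
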